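import Summits.BirchSwinnertonDyer.BirchSwinnertonDyer.Theorems.KolyvaginRoadThreeSchneiderTamAtThreeHeightLogNumeratorDeepLog
import Summits.BirchSwinnertonDyer.BirchSwinnertonDyer.Theorems.KolyvaginRoadThreeSchneiderTamAtThreeHeightLogNumeratorDeepConversion
import Summits.BirchSwinnertonDyer.BirchSwinnertonDyer.Theorems.KolyvaginRoadThreeSchneiderTamAtThreeHeightLogNumeratorSecondOrderCriterion
import HarnessLib

/-!
# Crux `SchneiderTamAtThree` (item 19154) — THE HEIGHT IS THE LOGARITHM OF THE NUMERATOR, DEEP POINTS,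
# part 3b/4: the DEEP-POINT LAW `ĥ₃(P) ≡ log₃ num x + ((b₂b₄ − 18b₆)/c₄)·den x/num x (mod 3^{2k+min(2k,ν)})`

HONEST FRAMING (cell `bsd-stepL`, seat `bsd-stepL-tam3-p2` g2, WIDTH-LEVER second lane «closed-form Schneider
local factor at 3 … finite case table proved once»; `--supports stmt-BirchSwinnertonDyer-19154 --as helper`):
THEOREMS ONLY, unconditional, route-independent (no Theses import); 0 definitions, 0 named facts, 0 sorry;
nothing here proves the crux `SchneiderTamAtThree`, Schneider's conjecture or BSD.

* `norm_heightFourOneCoord_sub_padicLog_num_sub_le_deep` — for `W/ℚ` globally minimal with multiplicative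
  reduction at `3`, any `q ∈ ℚ₃` with `‖q‖₃ < 1` and any rational point `P = (x, y)` of LEVEL `k ≥ 2`
  (`‖z(P)‖₃ = 3^{−k} ≤ 3⁻²`): **`‖ĥ₃(P) − log₃ num x − ((b₂b₄ − 18b₆)/c₄)·den x/num x‖₃ ≤
  ‖x‖₃⁻¹ · max(‖x‖₃⁻¹, ‖q‖₃)`**, i.e. the height agrees with the RATIONAL closed form
  `log₃ num x + κ₀'·den x/num x`, `κ₀' = (b₂b₄ − 18b₆)/c₄`, to `3^{2k + min(2k, ν)}`, `ν = v₃(q)` (for THE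
  Tate parameter `ν = v₃(Δ) = −v₃(j)`, the Kodaira type `I_ν`). The second-order law (part 3 of the
  second-order chain) is the case `min = 1`; numerically (kit j281722 + seat check, 690/690 rows of lane A's
  table) the true precision is `2k + min(2k, ν+1)`, the extra digit being the cancellation of the two
  `O(q)`-terms of `Π` and `C²` into `s − s₀` (not proved here).
  Mechanism: `ĥ₃ − log₃ num x = −log₃(x·Σ²)` and `x·Σ² = (x·ℓ²)·(2(ch L − 1)/L)·Π`; part 3a expands the
  first two logarithms to `O(‖z‖⁴)`, `‖log₃ Π‖ ≤ ‖q‖‖z‖²`; the sum is `κ_C ℓ² + Ω ℓ⁴` with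
  `κ_C = (C⁻² − b₂)/12`, `Ω = (6c₄ − 5b₂² − C⁻⁴)/1440`; part 2b converts `ℓ² ≡ x⁻¹ − (b₂/12)x⁻²`,
  `ℓ⁴ ≡ x⁻²`, and the `x⁻²`-coefficient `Ω − κ_C b₂/12 = −[(C⁻² − b₂)² + 12b₂(C⁻² − b₂) + 144b₄]/1440` is a
  `3`-adic INTEGER (from `C⁻² ≡ b₂ mod 3` alone) — the `ℓ⁴`-level cancellation; finally
  `κ_C ≡ −κ₀' (mod q)` (part 1 §4).

References: [SteinWuthrich2013] §4.1 (4.1), §4.2; [Iwasawa1972PadicL] §4.4; [SilvermanAEC2009] IV, VII.2;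
[SilvermanATAEC1994] V.3; tree: deep parts 1, 2a, 2b, 3a, 3a′ (conversion lemmas); second-order parts 1–3.
-/

noncomputable section

open scoped Classical Nat
open Filter Topology IsUltrametricDist PowerSeries
open WeierstrassCurve Literature.NumberTheory.EllipticCurves
open Literature.NumberTheory.EllipticCurves.SteinWuthrich2013
open Literature.NumberTheory.EllipticCurves.TateCurve
open Literature.NumberTheory.EllipticCurves.Rank1Residual
open Summit.BirchSwinnertonDyer.Uniform.UI.O2

namespace Summit.BirchSwinnertonDyer.Rank1Residual.X11b.RegMult.HeightLogNumerator

/-! ### §8 The deep-point law -/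

section Deep

variable {W : WeierstrassCurve ℚ}

/-- **THE DEEP-POINT LAW.** For `W/ℚ` globally minimal with multiplicative reduction at `3`, any `q ∈ ℚ₃`
with `‖q‖₃ < 1` and any rational affine point `P = (x, y)` with `‖z(P)‖₃ ≤ 3⁻²` (level `k ≥ 2`, i.e.
`3⁴ ∣ den x`): `‖ĥ₃(P) − log₃(num x) − ((b₂b₄ − 18b₆)/c₄)·(den x)/(num x)‖₃ ≤ ‖x‖₃⁻¹·max(‖x‖₃⁻¹, ‖q‖₃)`.
Thus the height is the rational closed form `log₃ a + κ₀'·D/a` (`a = num x`, `D = den x`,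
`κ₀' = (b₂b₄ − 18b₆)/c₄` from the minimal model) to precision `3^{2k + min(2k, ν)}`, `3^ν ‖ q`; for the
Tate parameter of `W` (`tateJ q = j`), `ν = v₃(Δ)`: the Kodaira type fixes the number of reliable digits.
Consequence (part 4): for `k ≥ d` and `3^d ∣ q`, `3^{2k+d} ∤ c₄(a³ − a) + 2(b₂b₄ − 18b₆)D ⟹ ĥ₃(P) ≠ 0`.
[cite: SteinWuthrich2013, §4.1 eq. (4.1), §4.2] [cite: Iwasawa1972PadicL, §4.4] [cite: SilvermanATAEC1994, Thm. V.3.1 (b)] -/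
theorem norm_heightFourOneCoord_sub_padicLog_num_sub_le_deep [W.IsElliptic] [W.IsGloballyMinimal]
    (hW : Mult W 3) {q : ℚ_[3]} (hq : ‖q‖ < 1) {x y : ℚ} (hxy : W.toAffine.Nonsingular x y)
    (hx : 1 < ‖(x : ℚ_[3])‖) (hz9 : ‖-(x : ℚ_[3]) / y‖ ≤ 1 / 9) :
    ‖heightFourOneCoord W 3 q x y - padicLog 3 ((x.num : ℚ) : ℚ_[3]) -
        ((W.baseChange ℚ_[3]).b₂ * (W.baseChange ℚ_[3]).b₄ - 18 * (W.baseChange ℚ_[3]).b₆) /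
          (W.baseChange ℚ_[3]).c₄ * (((x.den : ℚ) : ℚ_[3]) / ((x.num : ℚ) : ℚ_[3]))‖
      ≤ ‖(x : ℚ_[3])‖⁻¹ * max ‖(x : ℚ_[3])‖⁻¹ ‖q‖ := by
  -- the objects
  set X : ℚ_[3] := (x : ℚ_[3]) with hXdef
  set Y : ℚ_[3] := (y : ℚ_[3]) with hYdef
  set V : WeierstrassCurve ℚ_[3] := W.baseChange ℚ_[3] with hVdef
  set z : ℚ_[3] := -X / Y with hzdef
  set ℓ : ℚ_[3] := V.padicFormalLog z with hℓdef
  set C2 : ℚ_[3] := uniformisationScaleSq W 3 q with hC2def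
  set L : ℚ_[3] := logUnitParamSq W 3 q x y with hLdef
  set c : ℚ_[3] := coshOfSq L with hcdef
  set Pr : ℚ_[3] := ∏' n : ℕ, (1 - 2 * q ^ (n + 1) * c + q ^ (2 * (n + 1))) ^ 2 /
    (1 - q ^ (n + 1)) ^ 4 with hPrdef
  set κ' : ℚ_[3] := (V.b₂ * V.b₄ - 18 * V.b₆) / V.c₄ with hκ'def
  have hSig : tateSigmaValueSq W 3 q x y = C2 * (2 * (c - 1) * Pr) := rfl
  have hL : L = ℓ ^ 2 / C2 := rfl
  -- basic norms
  obtain ⟨hz, hz2⟩ := norm_neg_div_of_one_lt_norm (p := 3) hxy hx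
  have hX0 : 0 < ‖X‖ := one_pos.trans hx
  have hX0' : X ≠ 0 := norm_pos_iff.mp hX0
  have hXinv : ‖X‖⁻¹ = ‖z‖ ^ 2 := hz2.symm
  have hzz : 0 < ‖z‖ := by
    have h : 0 < ‖z‖ ^ 2 := by rw [hz2]; exact inv_pos.mpr hX0
    rcases (norm_nonneg z).eq_or_lt with h0 | h0
    · rw [← h0] at h; norm_num at h
    · exact h0
  have hz0 : z ≠ 0 := norm_pos_iff.mp hzz
  obtain ⟨hz1, h3z, h9z, h27z2, h3z2, hz2le, -, hr6, -, -, -, h3r5, hr6', -⟩ := deep_numerics ‖z‖ hzz hz9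
  obtain ⟨h2n, h4n, h3n, h3i, h9i, h12i, -, -, -, -⟩ := padic_three_constants
  have h81 : 81 * ‖z‖ ^ 2 ≤ 1 := by
    calc 81 * ‖z‖ ^ 2 = (9 * ‖z‖) * (9 * ‖z‖) := by ring
      _ ≤ 1 * 1 := mul_le_mul h9z h9z (by positivity) zero_le_one
      _ = 1 := one_mul _
  have hC : ‖C2‖ = 1 := norm_uniformisationScaleSq_eq_one hW hq
  have hC0 : C2 ≠ 0 := norm_pos_iff.mp (by rw [hC]; exact one_pos)
  have hCi : ‖C2⁻¹‖ = 1 := by rw [norm_inv, hC, inv_one]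
  have heq : V.toAffine.Equation X Y := (nonsingular_ratCast (p := 3) hxy).left
  obtain ⟨hsq, hxyn⟩ := V.norm_sq_eq_norm_cube heq hx
  have hY0 : Y ≠ 0 := norm_pos_iff.mp (hX0.trans hxyn)
  have hd0 : ((x.den : ℚ) : ℚ_[3]) ≠ 0 := by exact_mod_cast x.den_nz
  have hS0 := tateSigmaValueSq_ne_zero (p := 3) (by norm_num) hW hq hxy hx
  have hnum : ((x.num : ℚ) : ℚ_[3]) = X * ((x.den : ℚ) : ℚ_[3]) := by
    rw [hXdef, ← Rat.cast_mul, Rat.mul_den_eq_num]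
  -- the scale facts (part 1 §3, deep part 1 §4)
  obtain ⟨hb2n, hb4n, -⟩ : ‖V.b₂‖ ≤ 1 ∧ ‖V.b₄‖ ≤ 1 ∧ ‖V.b₆‖ ≤ 1 := by
    have h := V.eq_map_integralModel
    refine ⟨?_, ?_, ?_⟩
    · have e := congrArg WeierstrassCurve.b₂ h
      rw [map_b₂] at e; rw [← e]; exact PadicInt.norm_le_one _
    · have e := congrArg WeierstrassCurve.b₄ h
      rw [map_b₄] at e; rw [← e]; exact PadicInt.norm_le_one _
    · have e := congrArg WeierstrassCurve.b₆ h
      rw [map_b₆] at e; rw [← e]; exact PadicInt.norm_le_one _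
  have hCb : ‖C2⁻¹ - V.b₂‖ ≤ 1 / 3 := norm_inv_scaleSq_sub_b₂_le hW hq
  have hκq : ‖(C2⁻¹ - V.b₂) / 12 - -κ'‖ ≤ ‖q‖ := by
    rw [hκ'def, show -((V.b₂ * V.b₄ - 18 * V.b₆) / V.c₄) = (18 * V.b₆ - V.b₂ * V.b₄) / V.c₄ by ring]
    exact norm_kappa_sub_rational_le hW hq
  have hc4def : V.c₄ = V.b₂ ^ 2 - 24 * V.b₄ := rfl
  -- the three logarithms
  have hlog1 : ‖padicLog 3 (X * ℓ ^ 2) - (-(V.b₂ / 12) * ℓ ^ 2 + (V.c₄ / 240 - V.b₂ ^ 2 / 288) * ℓ ^ 4)‖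
      ≤ ‖z‖ ^ 4 := by
    have h := norm_padicLog_x_mul_formalLog_sq_sub_le V heq hx hz9
    rw [hXinv] at h
    exact h.trans_eq (by ring)
  have hXℓ : ‖X * ℓ ^ 2 - 1 + V.b₂ / 12 * ℓ ^ 2 - V.c₄ / 240 * ℓ ^ 4‖ ≤ ‖z‖ ^ 4 := by
    have h := norm_x_mul_formalLog_sq_sub_le V heq hx hz9
    rw [hXinv] at h
    exact h.trans_eq (by ring)
  have hℓτ := norm_padicFormalLog_sub_cubic_le_pow_four V (hz9.trans (by norm_num))
  have hℓn : ‖ℓ‖ = ‖z‖ := by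
    obtain ⟨ha1, ha2, -, -, -⟩ := V.norm_coeffs_le_one
    have hw : ‖ℓ - z‖ ≤ ‖z‖ ^ 2 := by
      have e : ℓ - z = (ℓ - (z + (2 : ℚ_[3])⁻¹ * V.a₁ * z ^ 2 + (3 : ℚ_[3])⁻¹ * (V.a₁ ^ 2 + V.a₂) * z ^ 3)) +
          ((2 : ℚ_[3])⁻¹ * V.a₁ * z ^ 2 + (3 : ℚ_[3])⁻¹ * (V.a₁ ^ 2 + V.a₂) * z ^ 3) := by ring
      rw [e]
      refine (norm_add_le_max _ _).trans (max_le (hℓτ.trans ?_) ((norm_add_le_max _ _).trans (max_le ?_ ?_)))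
      · calc ‖z‖ ^ 4 = ‖z‖ ^ 2 * ‖z‖ ^ 2 := by ring
          _ ≤ ‖z‖ ^ 2 * 1 := by gcongr; exact pow_le_one₀ (norm_nonneg _) hz1
          _ = ‖z‖ ^ 2 := mul_one _
      · rw [norm_mul, norm_mul, norm_inv, h2n, inv_one, one_mul, norm_pow]
        calc ‖V.a₁‖ * ‖z‖ ^ 2 ≤ 1 * ‖z‖ ^ 2 := by gcongr
          _ = ‖z‖ ^ 2 := one_mul _
      · rw [norm_mul, norm_mul, h3i, norm_pow]
        have ha12 : ‖V.a₁ ^ 2 + V.a₂‖ ≤ 1 := (norm_add_le_max _ _).trans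
          (max_le (by rw [norm_pow]; exact pow_le_one₀ (norm_nonneg _) ha1) ha2)
        calc 3 * ‖V.a₁ ^ 2 + V.a₂‖ * ‖z‖ ^ 3 ≤ 3 * 1 * ‖z‖ ^ 3 := by gcongr
          _ = (3 * ‖z‖) * ‖z‖ ^ 2 := by ring
          _ ≤ 1 * ‖z‖ ^ 2 := by gcongr
          _ = ‖z‖ ^ 2 := one_mul _
    rw [show ℓ = z + (ℓ - z) by ring]
    have hzlt : ‖z‖ ^ 2 < ‖z‖ := by
      calc ‖z‖ ^ 2 = ‖z‖ * ‖z‖ := sq _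
        _ < 1 * ‖z‖ := mul_lt_mul_of_pos_right (by linarith) hzz
        _ = ‖z‖ := one_mul _
    have hlt : ‖ℓ - z‖ < ‖z‖ := lt_of_le_of_lt hw hzlt
    rw [norm_add_eq_max_of_norm_ne_norm hlt.ne', max_eq_left hlt.le]
  have hℓ0 : ℓ ≠ 0 := norm_pos_iff.mp (by rw [hℓn]; exact hzz)
  have hLn : ‖L‖ = ‖z‖ ^ 2 := by rw [hL, norm_div, norm_pow, hℓn, hC, div_one]
  have hL0 : L ≠ 0 := norm_pos_iff.mp (by rw [hLn]; positivity)
  have hL81 : ‖L‖ ≤ 1 / 81 := by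
    rw [hLn]
    calc ‖z‖ ^ 2 = ‖z‖ * ‖z‖ := sq _
      _ ≤ (1 / 9) * (1 / 9) := mul_le_mul hz9 hz9 (norm_nonneg _) (by norm_num)
      _ = 1 / 81 := by norm_num
  have hlog2 : ‖padicLog 3 (2 * (c - 1) / L) - (L / 12 - L ^ 2 / 1440)‖ ≤ 81 * ‖L‖ ^ 3 :=
    norm_padicLog_two_mul_coshOfSq_sub_one_div_sub_le hL0 hL81
  have hc1 : ‖c - 1‖ ≤ ‖L‖ := by
    have hL' : ‖L‖ ≤ ((3 : ℝ)⁻¹) ^ 2 := hL81.trans (by norm_num)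
    obtain ⟨R, hR, hRle⟩ := coshOfSq_eq_one_add_half_add (p := 3) (by norm_num) hL'
    rw [hcdef, hR, show 1 + L / 2 + R - 1 = L / 2 + R by ring]
    refine (norm_add_le_max _ _).trans (max_le ?_ (hRle.trans ?_))
    · rw [div_eq_mul_inv, norm_mul, norm_inv, h2n, inv_one, mul_one]
    · calc ‖L‖ * ((3 : ℕ) : ℝ)⁻¹ ≤ ‖L‖ * 1 := by gcongr; norm_num
        _ = ‖L‖ := mul_one _
  have hcn : ‖c‖ ≤ 1 := by
    have hL' : ‖L‖ ≤ ((3 : ℝ)⁻¹) ^ 2 := hL81.trans (by norm_num)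
    exact (norm_coshOfSq_eq_one (p := 3) (by norm_num) hL').le
  have hPr : ‖Pr - 1‖ ≤ ‖q‖ * ‖z‖ ^ 2 := by
    refine (norm_tprod_tateSigmaSq_factor_sub_one_le_mul hq hcn).trans ?_
    rw [← hLn]; gcongr
  have hPr1 : ‖1 - Pr‖ < 1 := by
    rw [norm_sub_rev]; refine hPr.trans_lt ?_
    calc ‖q‖ * ‖z‖ ^ 2 ≤ 1 * ‖z‖ ^ 2 := mul_le_mul_of_nonneg_right hq.le (by positivity)
      _ = ‖z‖ ^ 2 := one_mul _
      _ ≤ ‖z‖ := hz2le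
      _ < 1 := lt_of_le_of_lt hz9 (by norm_num)
  have hlog3 : ‖padicLog 3 Pr‖ ≤ ‖q‖ * ‖z‖ ^ 2 := by
    rw [norm_padicLog_eq_norm_one_sub (p := 3) (by norm_num) hPr1, norm_sub_rev]; exact hPr
  have hPr0 : Pr ≠ 0 := by
    intro h; rw [h, sub_zero, norm_one] at hPr1; exact lt_irrefl _ hPr1
  have hcr0 : 2 * (c - 1) / L ≠ 0 := by
    intro h
    have h' := hlog2
    rw [h, padicLog_zero] at h'
    -- `‖L/12 − L²/1440‖ = 3‖L‖ > 81‖L‖³`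
    have h1440 : ‖(1440 : ℚ_[3])⁻¹‖ = 9 := by
      have h160 : ‖(160 : ℚ_[3])‖ = 1 := by
        simpa using Padic.norm_natCast_eq_one_iff.mpr (show Nat.Coprime 3 160 by decide)
      rw [show (1440 : ℚ_[3]) = 160 * (3 * 3) by norm_num, mul_inv, mul_inv, norm_mul, norm_mul, h3i,
        norm_inv, h160]; norm_num
    have hLpos : 0 < ‖L‖ := norm_pos_iff.mpr hL0
    have h3L1 : 3 * ‖L‖ < 1 := by linarith
    have hA : ‖L / 12‖ = 3 * ‖L‖ := by rw [div_eq_mul_inv, norm_mul, h12i, mul_comm]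
    have hB : ‖L ^ 2 / 1440‖ < ‖L / 12‖ := by
      rw [hA, div_eq_mul_inv, norm_mul, h1440, norm_pow]
      calc ‖L‖ ^ 2 * 9 = (3 * ‖L‖) * (3 * ‖L‖) := by ring
        _ < 1 * (3 * ‖L‖) := mul_lt_mul_of_pos_right h3L1 (by positivity)
        _ = 3 * ‖L‖ := one_mul _
    have hmain : ‖L / 12 - L ^ 2 / 1440‖ = 3 * ‖L‖ := by
      rw [sub_eq_add_neg, norm_add_eq_max_of_norm_ne_norm (by rw [norm_neg]; exact hB.ne'), norm_neg,
        max_eq_left hB.le, hA]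
    rw [zero_sub, norm_neg, hmain] at h'
    have hlt : 81 * ‖L‖ ^ 3 < 3 * ‖L‖ := by
      calc 81 * ‖L‖ ^ 3 = (81 * ‖L‖ ^ 2) * ‖L‖ := by ring
        _ ≤ (81 * (1 / 81) ^ 2) * ‖L‖ := by gcongr
        _ < 3 * ‖L‖ := mul_lt_mul_of_pos_right (by norm_num) hLpos
    linarith
  -- `ĥ − log num = −log(x Σ²) = −(log(xℓ²) + log(2(c−1)/L) + log Π)`
  have hXℓ0 : X * ℓ ^ 2 ≠ 0 := mul_ne_zero hX0' (pow_ne_zero 2 hℓ0)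
  have hdecomp : heightFourOneCoord W 3 q x y - padicLog 3 ((x.num : ℚ) : ℚ_[3]) =
      -(padicLog 3 (X * ℓ ^ 2) + padicLog 3 (2 * (c - 1) / L) + padicLog 3 Pr) := by
    have hprod : X * tateSigmaValueSq W 3 q x y = (X * ℓ ^ 2) * (2 * (c - 1) / L) * Pr := by
      rw [hSig, hL]; field_simp
    rw [heightFourOneCoord_eq, hnum, padicLog_mul_holds 3 hX0' hd0,
      show padicLog 3 ((x.den : ℚ) : ℚ_[3]) - padicLog 3 (tateSigmaValueSq W 3 q x y) -
        (padicLog 3 X + padicLog 3 ((x.den : ℚ) : ℚ_[3])) =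
        -(padicLog 3 X + padicLog 3 (tateSigmaValueSq W 3 q x y)) by ring,
      ← padicLog_mul_holds 3 hX0' hS0, hprod, padicLog_mul_holds 3 (mul_ne_zero hXℓ0 hcr0) hPr0,
      padicLog_mul_holds 3 hXℓ0 hcr0]
  -- `ℓ² ≡ X⁻¹ − (b₂/12) X⁻²`, `ℓ⁴ ≡ X⁻²`
  have hXi2 : ‖X⁻¹‖ = ‖z‖ ^ 2 := by rw [norm_inv, hXinv]
  clear_value X Y z ℓ C2 L c Pr
  have hXℓ' : ‖X * ℓ ^ 2 - 1 + V.b₂ / 12 * ℓ ^ 2 - (V.b₂ ^ 2 - 24 * V.b₄) / 240 * ℓ ^ 4‖ ≤ ‖z‖ ^ 4 := by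
    rw [← hc4def]; exact hXℓ
  obtain ⟨hK1, hK2, hK3⟩ := deep_conversion hX0' hXi2 hℓn hzz hz9 hb2n hb4n hCi hCb hXℓ'
  rw [← hc4def] at hK2 hK3
  -- the exact regrouping
  have hfin : heightFourOneCoord W 3 q x y - padicLog 3 ((x.num : ℚ) : ℚ_[3]) -
      κ' * (((x.den : ℚ) : ℚ_[3]) / ((x.num : ℚ) : ℚ_[3])) =
      -(padicLog 3 (X * ℓ ^ 2) - (-(V.b₂ / 12) * ℓ ^ 2 + (V.c₄ / 240 - V.b₂ ^ 2 / 288) * ℓ ^ 4))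
      - (padicLog 3 (2 * (c - 1) / L) - (L / 12 - L ^ 2 / 1440))
      - padicLog 3 Pr
      - (C2⁻¹ - V.b₂) / 12 * (ℓ ^ 2 - (X⁻¹ - V.b₂ / 12 * X⁻¹ ^ 2))
      - (6 * V.c₄ - 5 * V.b₂ ^ 2 - C2⁻¹ ^ 2) / 1440 * (ℓ ^ 4 - X⁻¹ ^ 2)
      - ((6 * V.c₄ - 5 * V.b₂ ^ 2 - C2⁻¹ ^ 2) / 1440 - (C2⁻¹ - V.b₂) / 12 * (V.b₂ / 12)) * X⁻¹ ^ 2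
      - ((C2⁻¹ - V.b₂) / 12 - -κ') * X⁻¹ := by
    rw [hdecomp, hnum, hL]
    field_simp
    ring
  rw [hfin, hXinv]
  have hB1 : ‖z‖ ^ 4 ≤ ‖z‖ ^ 2 * max (‖z‖ ^ 2) ‖q‖ := by
    rw [show ‖z‖ ^ 4 = ‖z‖ ^ 2 * ‖z‖ ^ 2 by ring]; gcongr; exact le_max_left _ _
  have hB2 : ‖q‖ * ‖z‖ ^ 2 ≤ ‖z‖ ^ 2 * max (‖z‖ ^ 2) ‖q‖ := by
    rw [mul_comm]; gcongr; exact le_max_right _ _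
  refine (norm_sub_le_max₃ _ _).trans (max_le ((norm_sub_le_max₃ _ _).trans (max_le
    ((norm_sub_le_max₃ _ _).trans (max_le ((norm_sub_le_max₃ _ _).trans (max_le
    ((norm_sub_le_max₃ _ _).trans (max_le ((norm_sub_le_max₃ _ _).trans (max_le ?_ ?_)) ?_)) ?_)) ?_)) ?_)) ?_)
  · rw [norm_neg]; exact hlog1.trans hB1
  · refine (hlog2.trans ?_).trans hB1
    rw [hLn]
    calc 81 * (‖z‖ ^ 2) ^ 3 = (81 * ‖z‖ ^ 2) * ‖z‖ ^ 4 := by ring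
      _ ≤ 1 * ‖z‖ ^ 4 := by gcongr
      _ = ‖z‖ ^ 4 := one_mul _
  · exact hlog3.trans hB2
  · exact hK1.trans hB1
  · exact hK2.trans hB1
  · exact hK3.trans hB1
  · rw [norm_mul, hXi2]
    calc ‖(C2⁻¹ - V.b₂) / 12 - -κ'‖ * ‖z‖ ^ 2 ≤ ‖q‖ * ‖z‖ ^ 2 := by gcongr
      _ ≤ _ := hB2

end Deep

end Summit.BirchSwinnertonDyer.Rank1Residual.X11b.RegMult.HeightLogNumerator

end
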